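import Summits.QuantumFields.YangMills.Theorems.TransportPerturbationGibbsInvarianceOfWilsonInvariant
import Summits.QuantumFields.YangMills.Theorems.ColdStartUniversalityLatticeLangevinWilsonInvariant
import HarnessLib

/-!
# Route `TransportPerturbation` — support `GibbsInvariance` (stmt-QuantumFields-26921) PROVED

Seat `ym-line-csu-p1`, g8.  The conditional closure `gibbsInvariance_of_wilsonInvariant` (seat `ym-line-sfw-p1`) took the named fact
`WilsonMeasureLangevinInvariant` (Shen–Zhu–Zhu, CMP 400 (2023), §3 Lemma 3.3) for `SU(2)`, `d = 3`, every `L`, `β` as hypothesis; that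
fact is now the tree theorem `ColdStartUniversality.wilsonMeasureLangevinInvariant_su2` (ground-state transform + Duhamel + Picard), so the
item closes unconditionally: `GibbsInvariance_proof`.  Measure-theoretic bookkeeping for the RECORD-label rung R3; no renormalisation-group
step and NOT the Yang–Mills mass gap.  No definition, no sorry.
-/

set_option autoImplicit false

noncomputable section

namespace Summit.QuantumFields.YangMills.Theorems.TransportPerturbation

open Literature.MathematicalPhysics.QuantumLattice (fundamentalLatticeRep)

/-- **`GibbsInvariance` (stmt-QuantumFields-26921) holds**: Bałaban's step-`K` Gibbs law is invariant under the transition operators of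
the SU(2) SZZ lattice Langevin dynamics — `gibbsInvariance_of_wilsonInvariant` fed with the tree theorem
`wilsonMeasureLangevinInvariant_su2` (SZZ Lemma 3.3 for all couplings). [cite: ShenZhuZhu2022, §3 Lemma 3.3 (p. 13)] -/
theorem GibbsInvariance_proof : Summit.QuantumFields.YangMills.Theses.TransportPerturbation.GibbsInvariance :=
  gibbsInvariance_of_wilsonInvariant fun L _ β => ColdStartUniversality.wilsonMeasureLangevinInvariant_su2 L β

end Summit.QuantumFields.YangMills.Theorems.TransportPerturbation

end
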